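import Summits.QuantumFields.YangMills.Theorems.BalabanUVNodesN13UVChiOffSolvableAtRecord13

/-!
# BalabanUVNodes ∕ N13 — K0e's THRESHOLD-HIERARCHY LEMMA WITH ITS `hcrit` HYPOTHESIS DISCHARGED: the critical configuration of record is
# `2εreg`-plaquette-small on BOTH branches of def-B's level-`(k+1)` solution map, so «χ^{(2.9),all}_k = 1 ⇒ V ∈ domAlt_k» and «the sharp domain indicator of
# record is invisible on the support of the fluctuation cutoff» hold UNCONDITIONALLY in the regime `2εreg + 4ε₁ ≤ ε₀`

Cell `pub-ymgap` (HUMAN RULING D-0062 Track A; D-0149 width seat `pub-ymgap-dag-n13-w1`, g2, INTENT-2), key K1⁷ `StabilityBAtRecordR13SepCoPH` = stmt-QuantumFields-20542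
(`--kind proof --supports … --as helper`).  [I] = [Balaban1987RG1], [III] = [Balaban1988Convergent], [Av] = [Balaban1985Averaging].

WHY.  K0e's `Node00/SmallFieldChi29OfRecord` §3 (THE THRESHOLD-HIERARCHY LEMMA, [IV] Prop 1 (1.78) ∕ [III] p. 265 l. 31–32 «on Ω^∼_{k+1} the functions χ_{Λ_k} and χ_k are equal to
1») carries the Prop-2 smallness of `∂V^{(k)}(W)` as a DISPLAYED hypothesis `hcrit : PlaqSmall δ (critCfgOfRecord F N ν K k V̄)` («never asserted»).  INTENT-1's
`dist1_plaqHol_critCfgOfRecord_lt` PROVES it at `δ := 2εreg` for EVERY `W`, on both branches of def-B's totalised level-`(k+1)` map (solvable ⇒ [Av] Prop. 2 via dag-n21-c's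
`plaqSmall_iter_Uk_level`; junk ⇒ `M^k(1) = 1`).  This file composes the two BY NAME: K0e's three statements with `hcrit` gone, in the numeric regime `2εreg + 4ε₁ ≤ ε₀`
(resp. `+ 4·max(ε₁, ε₁′)` for the printed form with the p. 266–267 rider).

WHAT THIS FILE PROVES (theorems only, 0 `def`): `plaqSmall_critCfgOfRecord` (K0e's `hcrit` at `δ = 2εreg`, every `W`); ★ `mem_domAltOfRecord_of_chiFix29All_eq_one_of_εreg`;
★ `chiFixAltOfRecord_mul_chiFix29All_of_εreg` (the sharp domain indicator of record is `1` on `supp χ^{(2.9),all}_k`, unconditionally in the regime);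
`mem_domAltOfRecord_of_chiFix29_eq_one_of_εreg` (printed form, modulo the rider `hb0` as in K0e); `plaqSmallOn_offB0_of_chiFix29OfRecord_eq_one` (the SUPPORT of
`χ^{(2.9)}_k` of record, threshold-explicit: `χ^{(2.9)} = 1 ⇒` every `b₀`-free plaquette is `(2εreg + 4ε₁)`-small).

HONEST FRAMING.  Count-neutral by-name composition; ONE printed estimate used ([Av] Prop. 2, a tree theorem); [15] Thm 1 NOT asserted (both branches treated);
nothing of the β-side provisos discharged beyond `hcrit`; N13 NOT discharged; K0⁷∕K1⁷ NOT closed; counts unmoved (5∕27 · A 5∕28); one finite `𝕋⁴_{L^K}` programme at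
fixed `ε = L^{−K}` — R4 closes the conditional finite-𝕋⁴ rung `BalabanLadder.UV` only; the YM mass gap (Clay) is NOT proved by any of this.  No `def`, no `sorry`, no `instance`.
-/

noncomputable section

open scoped Matrix.Norms.L2Operator

namespace Summit.QuantumFields.YangMills.BalabanUVNodes.N13Chi29CritCfgSmallAtRecord13

open Literature.MathematicalPhysics.QuantumFieldTheory.Balaban1983to89
open Literature.MathematicalPhysics.QuantumFieldTheory.Balaban1983to89.T4Continuum (T4Family)
open Literature.MathematicalPhysics.QuantumFieldTheory.Balaban1983to89.Node00
open ExpMeanLog (deltaSU)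
open Summit.QuantumFields.YangMills.BalabanUVNodes.N13UVChiOffSolvableAtRecord13 (dist1_plaqHol_critCfgOfRecord_lt)

variable {F : T4Family} {N : ℕ} [NeZero N] (ν : Stage7Numerics) {K k : ℕ}

/-- **K0e's `hcrit` IS A THEOREM at `δ = 2εreg`**: for every `W` on `T^{(k+1)}` the critical configuration of record `V^{(k)}(W)` has `|∂V^{(k)}(W) − 1| < 2εreg` at every
plaquette (`0 < εreg` in [Av] Prop. 2's range, `k ≤ m + K`) — INTENT-1's two-branch lemma in `PlaqSmall` dress. [cite: Balaban1985Averaging, Prop. 2 (52)–(54) p.26; Balaban1987RG1, (2.3) p.265] -/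
theorem plaqSmall_critCfgOfRecord (hk : k ≤ (F.P K).m + (F.P K).K) (hε : 0 < ν.εreg)
    (hε3 : (143 * (((((F.P K).d + 4 : ℕ) : ℝ)) ^ 2 / 4) ^ 2) * ν.εreg ≤ 1 / 3)
    (hε2 : 2 * ν.εreg ≤ 2 * deltaSU (Fin N) / ((((F.P K).d + 4) * (F.P K).L : ℕ) : ℝ) ^ 2)
    (W : GaugeField (F.P K) (k + 1) (SU N)) : PlaqSmall (2 * ν.εreg) (critCfgOfRecord F N ν K k W) :=
  fun p => dist1_plaqHol_critCfgOfRecord_lt ν hk hε hε3 hε2 W p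

/-- **★ THE THRESHOLD-HIERARCHY LEMMA, UNCONDITIONAL IN THE REGIME `2εreg + 4ε₁ ≤ ε₀`** (all-bonds form): `χ^{(2.9),all}_k(V) = 1 ⇒ V ∈ domAlt_k` — K0e's
`mem_domAltOfRecord_of_chiFix29All_eq_one` with `hcrit` supplied. [cite: Balaban1989LargeFieldI, Prop. 1 (1.78) p.194; Balaban1988Convergent, p.265; Balaban1985Averaging, Prop. 2 (54) p.26] -/
theorem mem_domAltOfRecord_of_chiFix29All_eq_one_of_εreg (hk : k ≤ (F.P K).m + (F.P K).K) (hε : 0 < ν.εreg)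
    (hε3 : (143 * (((((F.P K).d + 4 : ℕ) : ℝ)) ^ 2 / 4) ^ 2) * ν.εreg ≤ 1 / 3)
    (hε2 : 2 * ν.εreg ≤ 2 * deltaSU (Fin N) / ((((F.P K).d + 4) * (F.P K).L : ℕ) : ℝ) ^ 2)
    {ε₁ : ℝ} (hord : 2 * ν.εreg + 4 * ε₁ ≤ ν.ε₀) {V : GaugeField (F.P K) k (SU N)} (hχ : chiFix29AllOfRecord F N ν ε₁ K k V = 1) :
    V ∈ domAltOfRecord F N ν K k :=
  mem_domAltOfRecord_of_chiFix29All_eq_one hχ (plaqSmall_critCfgOfRecord ν hk hε hε3 hε2 _) hord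

/-- **★ THE SHARP DOMAIN INDICATOR OF RECORD IS INVISIBLE ON THE SUPPORT OF THE FLUCTUATION CUTOFF, UNCONDITIONALLY IN THE REGIME**: `χ^{alt}_k · χ^{(2.9),all}_k =
χ^{(2.9),all}_k` pointwise — K0e's product form `chiFixAltOfRecord_mul_chiFix29All` with `hcrit` supplied (the mechanism by which print never integrates an old `χ_k`
across a fibre in a small-field term). [cite: Balaban1988Convergent, p.265; Balaban1987RG1, (2.9) p.266; Balaban1985Averaging, Prop. 2 (54) p.26] -/
theorem chiFixAltOfRecord_mul_chiFix29All_of_εreg (hk : k ≤ (F.P K).m + (F.P K).K) (hε : 0 < ν.εreg)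
    (hε3 : (143 * (((((F.P K).d + 4 : ℕ) : ℝ)) ^ 2 / 4) ^ 2) * ν.εreg ≤ 1 / 3)
    (hε2 : 2 * ν.εreg ≤ 2 * deltaSU (Fin N) / ((((F.P K).d + 4) * (F.P K).L : ℕ) : ℝ) ^ 2)
    {ε₁ : ℝ} (hord : 2 * ν.εreg + 4 * ε₁ ≤ ν.ε₀) (V : GaugeField (F.P K) k (SU N)) :
    chiFixAltOfRecord F N ν K k V * chiFix29AllOfRecord F N ν ε₁ K k V = chiFix29AllOfRecord F N ν ε₁ K k V :=
  chiFixAltOfRecord_mul_chiFix29All V (plaqSmall_critCfgOfRecord ν hk hε hε3 hε2 _) hord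

/-- **PRINTED FORM, MODULO THE p. 266–267 RIDER** (K0e's `mem_domAltOfRecord_of_chiFix29_eq_one` with `hcrit` supplied): with (2.9) as printed and the excluded
`b₀(c)`-variables obeying the induced restriction `hb0`, `χ^{(2.9)}_k(V) = 1 ⇒ V ∈ domAlt_k` whenever `2εreg + 4·max(ε₁, ε₁′) ≤ ε₀`. [cite: Balaban1987RG1, (2.9) p.266 and p.267; Balaban1985Averaging, Prop. 2 (54) p.26] -/
theorem mem_domAltOfRecord_of_chiFix29_eq_one_of_εreg (hk : k ≤ (F.P K).m + (F.P K).K) (hε : 0 < ν.εreg)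
    (hε3 : (143 * (((((F.P K).d + 4 : ℕ) : ℝ)) ^ 2 / 4) ^ 2) * ν.εreg ≤ 1 / 3)
    (hε2 : 2 * ν.εreg ≤ 2 * deltaSU (Fin N) / ((((F.P K).d + 4) * (F.P K).L : ℕ) : ℝ) ^ 2)
    {ε₁ ε₁' : ℝ} (hord : 2 * ν.εreg + 4 * max ε₁ ε₁' ≤ ν.ε₀) {V : GaugeField (F.P K) k (SU N)} (hχ : chiFix29OfRecord F N ν ε₁ K k V = 1)
    (hb0 : ∀ b : PBond (F.P K) k, IsB0 b → fluctDevOfRecord F N ν K k V b ≤ ε₁') :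
    V ∈ domAltOfRecord F N ν K k :=
  mem_domAltOfRecord_of_chiFix29_eq_one hχ hb0 (plaqSmall_critCfgOfRecord ν hk hε hε3 hε2 _) hord

/-- **THE SUPPORT OF `χ^{(2.9)}_k` OF RECORD, THRESHOLD-EXPLICIT**: if `chiFix29OfRecord ν ε₁ K k V = 1` then EVERY plaquette of `V` none of whose four bonds is a distinguished
`b₀(c)` satisfies `|V(∂p) − 1| < 2εreg + 4ε₁` — the positive form of p593634's `chiFix29OfRecord_eq_zero_of_plaquette_off_b0` (both branches of def-B's level-`(k+1)` map):
modulo the `b₀` bonds, the (2.9) species of record IS a small-plaquette indicator with an explicit threshold. [cite: Balaban1987RG1, (2.9) p.266 and p.267; Balaban1985Averaging, Prop. 2 (54) p.26] -/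
theorem plaqSmallOn_offB0_of_chiFix29OfRecord_eq_one (hk : k ≤ (F.P K).m + (F.P K).K) (hε : 0 < ν.εreg)
    (hε3 : (143 * (((((F.P K).d + 4 : ℕ) : ℝ)) ^ 2 / 4) ^ 2) * ν.εreg ≤ 1 / 3)
    (hε2 : 2 * ν.εreg ≤ 2 * deltaSU (Fin N) / ((((F.P K).d + 4) * (F.P K).L : ℕ) : ℝ) ^ 2)
    {ε₁ : ℝ} {V : GaugeField (F.P K) k (SU N)} (hχ : chiFix29OfRecord F N ν ε₁ K k V = 1) :
    PlaqSmallOn {p : Plaq (F.P K) k | ¬ IsB0 (F := F) (⟨p.src, p.μ⟩ : PBond (F.P K) k) ∧ ¬ IsB0 (F := F) (⟨p.src.shift p.μ, p.ν⟩ : PBond (F.P K) k) ∧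
        ¬ IsB0 (F := F) (⟨p.src.shift p.ν, p.μ⟩ : PBond (F.P K) k) ∧ ¬ IsB0 (F := F) (⟨p.src, p.ν⟩ : PBond (F.P K) k)}
      (2 * ν.εreg + 4 * ε₁) V := by
  intro p hp
  refine lt_of_not_ge fun hbig => ?_
  have h0 := N13UVChiOffSolvableAtRecord13.chiFix29OfRecord_eq_zero_of_plaquette_off_b0 ν hk hε hε3 hε2 ε₁ V p hp.1 hp.2.1 hp.2.2.1 hp.2.2.2 hbig
  rw [h0] at hχ
  exact zero_ne_one hχ

end Summit.QuantumFields.YangMills.BalabanUVNodes.N13Chi29CritCfgSmallAtRecord13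

end
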